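import Literature.Probability.LatticeModels.IsingSAWBound
import Literature.Probability.RandomPlanarGeometry.SAWCountStepWords
import Mathlib.Algebra.Order.Field.GeomSum
import HarnessLib

/-!
# Fisher's bound in canonical form: `μ(d) · tanh β < 1 ⇒ β < β_c(d)`, i.e. `tanh β_c(d) ≥ 1/μ(d)`

Topic `Literature/Probability/LatticeModels`. Theorem-only file (no definition, no named fact, no sorry).

M. E. Fisher, *Critical temperatures of anisotropic Ising lattices. II. General upper bounds*, Phys. Rev.
162 (1967) 480–485, bounds the critical temperature of the nearest-neighbour Ising ferromagnet on a lattice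
from above by the self-avoiding-walk connective constant `μ` of that lattice: `tanh(J/k_B T_c) ≥ 1/μ`.
The tree's `isingTwoPoint_free_le_sawSum` / `lt_criticalBeta_of_sawSum_le` (`IsingSAWBound.lean`) is the
underlying pair-correlation bound and Fisher's criterion with a bounded self-avoiding-walk generating
function as hypothesis. This file closes the loop with the tree's connective constant
`SAW.Zd.connectiveConstant d = μ(d) = lim cₙ^{1/n}` (Madras–Slade §1.2, `SAW.Zd.tendsto_count_rpow`) through
the identification `#sawWords d n = cₙ` (`SAW.Zd.card_sawWords_eq_count`):

* `sawSum_le_of_connectiveConstant_mul_lt_one` — `μ(d)·t < 1`, `t ≥ 0` ⇒ the generating function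
  `∑_{n<N} cₙ tⁿ` is bounded uniformly in `N` (root test);
* `lt_criticalBeta_of_connectiveConstant_mul_tanh_lt_one` — **`μ(d)·tanh β < 1 ⇒ β < β_c(d)`** (`d ≥ 2`,
  `β ≥ 0`): Fisher's `tanh β_c ≥ 1/μ`;
* `lt_criticalBeta_of_le_of_mul_tanh_lt_one` — the same from any upper bound `μ(d) ≤ μ̄`: `μ̄·tanh β < 1 ⇒ β < β_c(d)`
  (the form in which a certified bound on `μ`, e.g. a finite-memory automaton count, becomes a bound on `β_c`);
* `inv_connectiveConstant_le_tanh_of_criticalBeta_le` — contrapositive reading `β_c(d) ≤ β ⇒ 1/μ(d) ≤ tanh β`.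
With the tree's kernel-checked `SAW.Zd.connectiveConstant_three_le_476 : μ(3) ≤ 4.76` (`SAWFiniteMemoryZ3K10.lean`) the
second form gives `β_c(3) > artanh(1/4.76) = 0.2132…` (not restated here).

References: M. E. Fisher, Phys. Rev. 162 (1967) 480 [Fisher1967]; N. Madras, G. Slade, *The Self-Avoiding Walk*
(1993), §1.2 [MadrasSlade1993].
-/

noncomputable section

open Finset Filter Topology

namespace Literature.Probability.LatticeModels

open Literature.Probability.Percolation
open Literature.Probability.RandomPlanarGeometry.SAW.Zd (connectiveConstant count card_sawWords_eq_count
  tendsto_count_rpow)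

variable {d : ℕ}

/-- **Root test for the self-avoiding-walk generating function**: if `μ(d)·t < 1` (`t ≥ 0`, `d ≥ 1`) then
`∑_{n<N} cₙ tⁿ ≤ K` for one `K` and all `N` (`cₙ^{1/n} → μ(d)`, so `cₙ ≤ rⁿ` eventually for any `r > μ(d)`; take
`r` with `r t < 1`). [cite: MadrasSlade1993, §1.2 ((1.2.9); χ(z) = Σ cₙ zⁿ converges for z < 1/μ, §1.3)] -/
theorem sawSum_le_of_connectiveConstant_mul_lt_one [NeZero d] {t : ℝ} (ht0 : 0 ≤ t)
    (h : connectiveConstant d * t < 1) :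
    ∃ K : ℝ, ∀ N : ℕ, ∑ n ∈ range N, ((sawWords d n).card : ℝ) * t ^ n ≤ K := by
  -- a ratio `r > μ(d)` with `r t < 1`
  obtain ⟨r, hμr, hrt⟩ : ∃ r : ℝ, connectiveConstant d < r ∧ r * t < 1 := by
    rcases eq_or_lt_of_le ht0 with ht | ht
    · exact ⟨connectiveConstant d + 1, by linarith, by rw [← ht]; simp⟩
    · refine ⟨(connectiveConstant d + 1 / t) / 2, ?_, ?_⟩
      · have : connectiveConstant d < 1 / t := by rw [lt_div_iff₀ ht]; exact h
        linarith
      · have : connectiveConstant d * t < 1 := h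
        have h1 : (connectiveConstant d + 1 / t) / 2 * t = (connectiveConstant d * t + 1) / 2 := by
          field_simp
        rw [h1]; linarith
  have hr0 : 0 ≤ r := le_of_lt (lt_of_le_of_lt
    (Literature.Probability.RandomPlanarGeometry.SAW.Zd.connectiveConstant_nonneg d) hμr)
  have hrt0 : 0 ≤ r * t := mul_nonneg hr0 ht0
  -- eventually `cₙ ≤ rⁿ`
  have hev : ∀ᶠ n : ℕ in atTop, (count d n : ℝ) ≤ r ^ n := by
    filter_upwards [(tendsto_count_rpow d).eventually (gt_mem_nhds hμr), eventually_ge_atTop 1] with n hn hn1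
    have hc0 : (0 : ℝ) ≤ count d n := Nat.cast_nonneg _
    have hpow : ((count d n : ℝ) ^ (1 / (n : ℝ))) ^ n = count d n := by
      rw [← Real.rpow_natCast, ← Real.rpow_mul hc0, one_div,
        inv_mul_cancel₀ (by exact_mod_cast (show n ≠ 0 by omega)), Real.rpow_one]
    rw [← hpow]
    exact pow_le_pow_left₀ (Real.rpow_nonneg hc0 _) hn.le n
  obtain ⟨N₀, hN₀⟩ := eventually_atTop.1 hev
  refine ⟨∑ n ∈ range N₀, (count d n : ℝ) * t ^ n + 1 / (1 - r * t), fun N => ?_⟩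
  have hterm0 : ∀ n, (0 : ℝ) ≤ (count d n : ℝ) * t ^ n := fun n => by positivity
  simp_rw [card_sawWords_eq_count]
  calc ∑ n ∈ range N, (count d n : ℝ) * t ^ n
      ≤ ∑ n ∈ range (max N N₀), (count d n : ℝ) * t ^ n :=
        sum_le_sum_of_subset_of_nonneg (range_mono (le_max_left _ _)) fun n _ _ => hterm0 n
    _ = ∑ n ∈ range N₀, (count d n : ℝ) * t ^ n + ∑ n ∈ Ico N₀ (max N N₀), (count d n : ℝ) * t ^ n := by
        simp only [range_eq_Ico]
        exact (sum_Ico_consecutive _ (Nat.zero_le N₀) (le_max_right N N₀)).symm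
    _ ≤ ∑ n ∈ range N₀, (count d n : ℝ) * t ^ n + ∑ n ∈ Ico N₀ (max N N₀), (r * t) ^ n := by
        refine add_le_add le_rfl (sum_le_sum fun n hn => ?_)
        rw [mul_pow]
        exact mul_le_mul_of_nonneg_right (hN₀ n (mem_Ico.1 hn).1) (pow_nonneg ht0 n)
    _ ≤ ∑ n ∈ range N₀, (count d n : ℝ) * t ^ n + 1 / (1 - r * t) := by
        refine add_le_add le_rfl ((geom_sum_Ico_le_of_lt_one hrt0 hrt).trans ?_)
        exact div_le_div_of_nonneg_right (pow_le_one₀ hrt0 hrt.le) (by linarith)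

/-- **FISHER 1967 — `μ(d)·tanh β < 1 ⇒ β < β_c(d)`** (`d ≥ 2`, `β ≥ 0`), i.e. `tanh β_c(d) ≥ 1/μ(d)`: the
critical temperature of the nearest-neighbour Ising model on `ℤ^d` is bounded by the self-avoiding-walk
connective constant `μ(d) = SAW.Zd.connectiveConstant d`. PROOF: Fisher's pair-correlation bound summed
(`lt_criticalBeta_of_sawSum_le`: a bounded SAW generating function at `tanh β` forces `χ(β) < ∞`, and `χ = ∞` on
`[β_c, ∞)`) with the root test `sawSum_le_of_connectiveConstant_mul_lt_one`.
[cite: Fisher1967, Phys. Rev. 162 (1967) 480 (tanh(J/kT_c) ≥ 1/μ)] -/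
theorem lt_criticalBeta_of_connectiveConstant_mul_tanh_lt_one (hd : 2 ≤ d) {β : ℝ} (hβ : 0 ≤ β)
    (h : connectiveConstant d * Real.tanh β < 1) : β < criticalBeta d := by
  haveI : NeZero d := ⟨by omega⟩
  obtain ⟨K, hK⟩ := sawSum_le_of_connectiveConstant_mul_lt_one (tanh_nonneg hβ) h
  exact lt_criticalBeta_of_sawSum_le hd hβ hK

/-- **Fisher's bound from any certified upper bound on the connective constant**: `μ(d) ≤ μ̄` and
`μ̄·tanh β < 1` (`d ≥ 2`, `β ≥ 0`) ⇒ `β < β_c(d)`. [cite: Fisher1967, Phys. Rev. 162 (1967) 480 (tanh(J/kT_c) ≥ 1/μ)] -/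
theorem lt_criticalBeta_of_le_of_mul_tanh_lt_one (hd : 2 ≤ d) {β μbar : ℝ} (hβ : 0 ≤ β)
    (hμ : connectiveConstant d ≤ μbar) (h : μbar * Real.tanh β < 1) : β < criticalBeta d :=
  lt_criticalBeta_of_connectiveConstant_mul_tanh_lt_one hd hβ
    ((mul_le_mul_of_nonneg_right hμ (tanh_nonneg hβ)).trans_lt h)

/-- **`β_c(d) ≤ β ⇒ 1/μ(d) ≤ tanh β`** (`d ≥ 2`, `β ≥ 0`): the contrapositive reading of Fisher's bound,
`tanh β_c(d) ≥ 1/μ(d)`. [cite: Fisher1967, Phys. Rev. 162 (1967) 480 (tanh(J/kT_c) ≥ 1/μ)] -/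
theorem inv_connectiveConstant_le_tanh_of_criticalBeta_le (hd : 2 ≤ d) {β : ℝ} (hβ : 0 ≤ β)
    (h : criticalBeta d ≤ β) : (connectiveConstant d)⁻¹ ≤ Real.tanh β := by
  haveI : NeZero d := ⟨by omega⟩
  have hμ : 0 < connectiveConstant d :=
    Literature.Probability.RandomPlanarGeometry.SAW.Zd.connectiveConstant_pos d
  by_contra hlt
  have : connectiveConstant d * Real.tanh β < 1 := by
    have := mul_lt_mul_of_pos_left (not_le.1 hlt) hμ
    rwa [mul_inv_cancel₀ hμ.ne'] at this
  exact (not_lt.2 h) (lt_criticalBeta_of_connectiveConstant_mul_tanh_lt_one hd hβ this)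

end Literature.Probability.LatticeModels


end
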